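import Mathlib
import HarnessLib
import Literature.Analysis.Calculus.IteratedDerivCompBound
import Summits.HubbardSuperconductivity.HubbardSuperconductivity.Theorems.KLProgrammeC4aPPKernelSmoothScaleJets
import Summits.HubbardSuperconductivity.HubbardSuperconductivity.Theorems.KLProgrammeC4aPPKernelSplitProfile

/-!
# Route `KLProgramme` — crux C4a, S3 brick (B4) «(B4)-UMK1», «PIECES ALL ORDERS» part 2: the partition factors `κ(r(e,·))`, `κ(1 − r(e,·))` and the
# comparable-levels factor `1 − κ(r) − κ(1−r)` have bounded `u`-jets AT EVERY ORDER — `≤ n!·X_κ·((n!)²·(4/t₁)/(m̃ₑ+m̃ᵤ))ⁿ`, zero off the transition zones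

Cell `gate-hubbard-kl`, seat hubbard-kl-k3c3-p1 (g20; row «δμ-flow with klAngularMean constant piece»).  Companion of `…C4aPPKernelSmoothScaleJets` (part 1: the Gevrey-2
jets of `m̃` and `r`).  The one-partition pieces of `…C4aPPKernelSmoothPartition` are `A_s = P·κ(r)` and `M_s = P·(1 − κ(r) − κ(1−r))` with a smooth profile
`κ = 1` on `(−∞, t₁/2]`, `κ = 0` on `[t₁, ∞)` (the tree's `ppSplitProfile t₁`); their order-`≤ 2` jets were typed by hand in `…MidCalculus` / `…FarSRows`.  Here,
for an ABSTRACT smooth profile with a jet table `|κ⁽ⁱ⁾| ≤ X_κ` (`i ≤ n`), and then for `ppSplitProfile t₁` itself: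
* §1 `sq_factorial_mul_pow_le_pow` (Gevrey-2 jets `(i!)²ρⁱ` are geometric `((n!)²ρ)ⁱ` for `1 ≤ i ≤ n`);
* §2 ON THE ZONE `c·(m̃ₑ+m̃ᵤ) ≤ m̃ᵤ`: **`abs_iteratedDeriv_comp_ppSmoothRatio_le_of_zone`** (`|∂ᵤⁿ κ(r(e,·))(u)| ≤ n!·X_κ·((n!)²(2/c)/(m̃ₑ+m̃ᵤ))ⁿ`, Faà di Bruno
  `Literature…IteratedDerivCompBound` on part 1's zone form) and the same for `κ(1 − r(e,·))`;
* §3 OFF THE ZONES the jets vanish by local constancy: `iteratedDeriv_comp_ppSmoothRatio_eq_zero_of_lt/_of_gt` (`r < t₁/2`: `κ∘r ≡ 1` near `u`; `t₁ < r`: `≡ 0`),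
  and the `1 − r` twins; the zone algebra `zone_of_ppSmoothRatio_le` (`r ≤ t₁ ⟹ (1−t₁)(m̃ₑ+m̃ᵤ) ≤ m̃ᵤ`), `zone_of_le_one_sub_ppSmoothRatio` (`t₁/2 ≤ 1−r ⟹ (t₁/2)(m̃ₑ+m̃ᵤ) ≤ m̃ᵤ`);
* §4 EVERY `u`: **`abs_iteratedDeriv_comp_ppSmoothRatio_le`** (`|∂ᵤⁿ κ(r(e,·))(u)| ≤ n!·X_κ·((n!)²·(4/t₁)·(1/(m̃ₑ+m̃ᵤ)))ⁿ`, `0 < t₁ ≤ 2/3`),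
  **`abs_iteratedDeriv_comp_one_sub_ppSmoothRatio_le`** (same), **`abs_iteratedDeriv_midFactor_le`** (`|∂ᵤⁿ(1 − κ(r) − κ(1−r))| ≤ [n = 0] + 2·n!·X_κ·(…)ⁿ`);
* §5 the concrete profile: `iteratedDeriv_ppSplitProfile` (`= (2/t₁)ⁿ·(−1)ⁿ·smoothTransition⁽ⁿ⁾(2 − 2t/t₁)`), **`abs_iteratedDeriv_ppSplitProfile_le`**
  (`≤ 8·(n!)²·(512/t₁)ⁿ`, the Literature Gevrey-2 numeral table of `smoothTransition`), `ppSplitProfile_jetTable` (`∀ i ≤ n`, flat `X_κ = 8(n!)²(512/t₁)ⁿ`).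
Part 3 (`…C4aPPKernelPiecesJetsAllOrders`): Leibniz with the kernel's jets, rows in the law currency, joint continuity.
Pure real analysis on landed objects; nothing asserts (C), any engine row, K3, the window or superconductivity.
References: BGM 2006 §2.4 (2.36) [cite: BenfattoGiulianiMastropietro2006]; Disertori–Rivasseau 2000 §II.2 (II.14) footnote [cite: DisertoriRivasseau2000].
-/

noncomputable section

namespace Summit.HubbardSuperconductivity.HubbardSuperconductivity.Theorems.C4a

set_option linter.dupNamespace false -- summit = problem name (single-conjunct summit), D-0017

open Real Filter Set Finset
open scoped Topology Nat
open Literature.MathematicalPhysics.QuantumLattice Literature.Analysis.SpecialFunctions Literature.Analysis.Calculus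

/-! ## §1 Gevrey-2 jets are geometric up to a fixed order -/

/-- `(i!)²·ρⁱ ≤ ((n!)²·ρ)ⁱ` for `1 ≤ i ≤ n`, `0 ≤ ρ`. [folklore] -/
theorem sq_factorial_mul_pow_le_pow {i n : ℕ} (hi1 : 1 ≤ i) (hin : i ≤ n) {ρ : ℝ} (hρ : 0 ≤ ρ) :
    ((i ! : ℝ)) ^ 2 * ρ ^ i ≤ (((n ! : ℝ)) ^ 2 * ρ) ^ i := by
  rw [mul_pow]
  refine mul_le_mul_of_nonneg_right ?_ (by positivity)
  have h1 : ((i ! : ℝ)) ^ 2 ≤ ((n ! : ℝ)) ^ 2 := by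
    have : ((i ! : ℝ)) ≤ n ! := by exact_mod_cast Nat.factorial_le hin
    gcongr
  have h2 : (1 : ℝ) ≤ ((n ! : ℝ)) ^ 2 := by
    have : (1 : ℝ) ≤ n ! := by exact_mod_cast Nat.succ_le_of_lt (Nat.factorial_pos n)
    nlinarith
  calc ((i ! : ℝ)) ^ 2 ≤ ((n ! : ℝ)) ^ 2 := h1
    _ = (((n ! : ℝ)) ^ 2) ^ 1 := (pow_one _).symm
    _ ≤ (((n ! : ℝ)) ^ 2) ^ i := pow_le_pow_right₀ h2 hi1

/-! ## §2 On a zone: Faà di Bruno -/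

section Zone

variable {lo : ℝ} (hlo : 0 < lo) {κ : ℝ → ℝ} (hκ : ContDiff ℝ (⊤ : ℕ∞) κ) {n : ℕ} {Xκ : ℝ} (hX : ∀ i ≤ n, ∀ t : ℝ, |iteratedDeriv i κ t| ≤ Xκ)
include hlo hκ hX

/-- **`κ(r(e,·))` on a zone** `c·(m̃ₑ+m̃ᵤ) ≤ m̃ᵤ`: `|∂ᵤⁿ κ(r(e,·))(u)| ≤ n!·X_κ·((n!)²·(2/c)·(1/(m̃ₑ+m̃ᵤ)))ⁿ`. [cite: BenfattoGiulianiMastropietro2006, §2.4 (2.36)] -/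
theorem abs_iteratedDeriv_comp_ppSmoothRatio_le_of_zone {c : ℝ} (hc : 0 < c) {e u : ℝ}
    (hz : c * (ppSmoothScale lo e + ppSmoothScale lo u) ≤ ppSmoothScale lo u) :
    |iteratedDeriv n (fun v : ℝ => κ (ppSmoothRatio lo e v)) u| ≤
      n ! * Xκ * (((n ! : ℝ)) ^ 2 * (2 / c) * (1 / (ppSmoothScale lo e + ppSmoothScale lo u))) ^ n := by
  have ha := ppSmoothScale_pos hlo e
  have hs := ppSmoothScale_pos hlo u
  have hfun : (fun v : ℝ => κ (ppSmoothRatio lo e v)) = κ ∘ fun v : ℝ => ppSmoothRatio lo e v := rfl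
  rw [hfun, ← Real.norm_eq_abs]
  refine norm_iteratedDeriv_comp_le_of_contDiffOn isOpen_univ (mem_univ u) (hκ.of_le (by exact_mod_cast le_top))
    ((contDiff_ppSmoothRatio hlo e (n := n)).contDiffOn) (fun i hi => ?_) (fun i hi1 hin => ?_)
  · rw [Real.norm_eq_abs]; exact hX i hi _
  · rw [Real.norm_eq_abs]
    refine (abs_iteratedDeriv_ppSmoothRatio_le_of_zone hlo hc hz i).trans ?_
    rw [mul_assoc, ← mul_pow, mul_assoc]
    exact sq_factorial_mul_pow_le_pow hi1 hin (by positivity)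

/-- The same for `κ(1 − r(e,·))`. [cite: BenfattoGiulianiMastropietro2006, §2.4 (2.36)] -/
theorem abs_iteratedDeriv_comp_one_sub_ppSmoothRatio_le_of_zone {c : ℝ} (hc : 0 < c) {e u : ℝ}
    (hz : c * (ppSmoothScale lo e + ppSmoothScale lo u) ≤ ppSmoothScale lo u) :
    |iteratedDeriv n (fun v : ℝ => κ (1 - ppSmoothRatio lo e v)) u| ≤
      n ! * Xκ * (((n ! : ℝ)) ^ 2 * (2 / c) * (1 / (ppSmoothScale lo e + ppSmoothScale lo u))) ^ n := by
  have ha := ppSmoothScale_pos hlo e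
  have hs := ppSmoothScale_pos hlo u
  have hfun : (fun v : ℝ => κ (1 - ppSmoothRatio lo e v)) = κ ∘ fun v : ℝ => 1 - ppSmoothRatio lo e v := rfl
  rw [hfun, ← Real.norm_eq_abs]
  refine norm_iteratedDeriv_comp_le_of_contDiffOn isOpen_univ (mem_univ u) (hκ.of_le (by exact_mod_cast le_top))
    ((contDiff_const.sub (contDiff_ppSmoothRatio hlo e (n := n))).contDiffOn) (fun i hi => ?_) (fun i hi1 hin => ?_)
  · rw [Real.norm_eq_abs]; exact hX i hi _
  · rw [Real.norm_eq_abs]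
    refine (abs_iteratedDeriv_one_sub_ppSmoothRatio_le_of_zone hlo hc hz i).trans ?_
    rw [mul_assoc, ← mul_pow, mul_assoc]
    exact sq_factorial_mul_pow_le_pow hi1 hin (by positivity)

end Zone

/-! ## §3 Off the zones the jets vanish; the zone algebra -/

/-- `r(e,·)` is continuous. [folklore] -/
theorem continuous_ppSmoothRatio_u {lo : ℝ} (hlo : 0 < lo) (e : ℝ) : Continuous fun v : ℝ => ppSmoothRatio lo e v :=
  (contDiff_ppSmoothRatio hlo e (n := 0)).continuous

/-- Below the lower edge (`r(e,u) < t₁/2`) the factor `κ(r(e,·))` is `1` near `u`: its jets of order `≥ 1` vanish. [folklore] -/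
theorem iteratedDeriv_comp_ppSmoothRatio_eq_zero_of_lt {lo : ℝ} (hlo : 0 < lo) {κ : ℝ → ℝ} {t₁ : ℝ} (h1 : ∀ t, t ≤ t₁ / 2 → κ t = 1)
    {e u : ℝ} (hr : ppSmoothRatio lo e u < t₁ / 2) {j : ℕ} (hj : 1 ≤ j) :
    iteratedDeriv j (fun v : ℝ => κ (ppSmoothRatio lo e v)) u = 0 := by
  have hev : (fun v : ℝ => κ (ppSmoothRatio lo e v)) =ᶠ[𝓝 u] fun _ => (1 : ℝ) := by
    have hopen : IsOpen {v : ℝ | ppSmoothRatio lo e v < t₁ / 2} := isOpen_lt (continuous_ppSmoothRatio_u hlo e) continuous_const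
    filter_upwards [hopen.mem_nhds hr] with v hv
    exact h1 _ (le_of_lt hv)
  rw [hev.iteratedDeriv_eq, iteratedDeriv_const]
  simp [Nat.one_le_iff_ne_zero.1 hj]

/-- Above the upper edge (`t₁ < r(e,u)`) the factor `κ(r(e,·))` is `0` near `u`: all its jets vanish. [folklore] -/
theorem iteratedDeriv_comp_ppSmoothRatio_eq_zero_of_gt {lo : ℝ} (hlo : 0 < lo) {κ : ℝ → ℝ} {t₁ : ℝ} (h0 : ∀ t, t₁ ≤ t → κ t = 0)
    {e u : ℝ} (hr : t₁ < ppSmoothRatio lo e u) (j : ℕ) :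
    iteratedDeriv j (fun v : ℝ => κ (ppSmoothRatio lo e v)) u = 0 := by
  have hev : (fun v : ℝ => κ (ppSmoothRatio lo e v)) =ᶠ[𝓝 u] fun _ => (0 : ℝ) := by
    have hopen : IsOpen {v : ℝ | t₁ < ppSmoothRatio lo e v} := isOpen_lt continuous_const (continuous_ppSmoothRatio_u hlo e)
    filter_upwards [hopen.mem_nhds hr] with v hv
    exact h0 _ (le_of_lt hv)
  rw [hev.iteratedDeriv_eq, iteratedDeriv_const]
  simp

/-- The `1 − r` twin below the lower edge. [folklore] -/
theorem iteratedDeriv_comp_one_sub_ppSmoothRatio_eq_zero_of_lt {lo : ℝ} (hlo : 0 < lo) {κ : ℝ → ℝ} {t₁ : ℝ} (h1 : ∀ t, t ≤ t₁ / 2 → κ t = 1)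
    {e u : ℝ} (hr : 1 - ppSmoothRatio lo e u < t₁ / 2) {j : ℕ} (hj : 1 ≤ j) :
    iteratedDeriv j (fun v : ℝ => κ (1 - ppSmoothRatio lo e v)) u = 0 := by
  have hev : (fun v : ℝ => κ (1 - ppSmoothRatio lo e v)) =ᶠ[𝓝 u] fun _ => (1 : ℝ) := by
    have hopen : IsOpen {v : ℝ | 1 - ppSmoothRatio lo e v < t₁ / 2} :=
      isOpen_lt (continuous_const.sub (continuous_ppSmoothRatio_u hlo e)) continuous_const
    filter_upwards [hopen.mem_nhds hr] with v hv
    exact h1 _ (le_of_lt hv)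
  rw [hev.iteratedDeriv_eq, iteratedDeriv_const]
  simp [Nat.one_le_iff_ne_zero.1 hj]

/-- The `1 − r` twin above the upper edge. [folklore] -/
theorem iteratedDeriv_comp_one_sub_ppSmoothRatio_eq_zero_of_gt {lo : ℝ} (hlo : 0 < lo) {κ : ℝ → ℝ} {t₁ : ℝ} (h0 : ∀ t, t₁ ≤ t → κ t = 0)
    {e u : ℝ} (hr : t₁ < 1 - ppSmoothRatio lo e u) (j : ℕ) :
    iteratedDeriv j (fun v : ℝ => κ (1 - ppSmoothRatio lo e v)) u = 0 := by
  have hev : (fun v : ℝ => κ (1 - ppSmoothRatio lo e v)) =ᶠ[𝓝 u] fun _ => (0 : ℝ) := by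
    have hopen : IsOpen {v : ℝ | t₁ < 1 - ppSmoothRatio lo e v} :=
      isOpen_lt continuous_const (continuous_const.sub (continuous_ppSmoothRatio_u hlo e))
    filter_upwards [hopen.mem_nhds hr] with v hv
    exact h0 _ (le_of_lt hv)
  rw [hev.iteratedDeriv_eq, iteratedDeriv_const]
  simp

/-- **Zone algebra, far transition**: `r(e,u) ≤ t₁ < 1 ⟹ (1−t₁)·(m̃ₑ+m̃ᵤ) ≤ m̃ᵤ`. [folklore] -/
theorem zone_of_ppSmoothRatio_le {lo : ℝ} (hlo : 0 < lo) {t₁ e u : ℝ} (hr : ppSmoothRatio lo e u ≤ t₁) :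
    (1 - t₁) * (ppSmoothScale lo e + ppSmoothScale lo u) ≤ ppSmoothScale lo u := by
  have ha := ppSmoothScale_pos hlo e
  have hs := ppSmoothScale_pos hlo u
  unfold ppSmoothRatio at hr
  rw [div_le_iff₀ (by positivity)] at hr
  nlinarith

/-- **Zone algebra, comparable transition**: `t₁/2 ≤ 1 − r(e,u) ⟹ (t₁/2)·(m̃ₑ+m̃ᵤ) ≤ m̃ᵤ`. [folklore] -/
theorem zone_of_le_one_sub_ppSmoothRatio {lo : ℝ} (hlo : 0 < lo) {t₁ e u : ℝ} (hr : t₁ / 2 ≤ 1 - ppSmoothRatio lo e u) :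
    t₁ / 2 * (ppSmoothScale lo e + ppSmoothScale lo u) ≤ ppSmoothScale lo u := by
  have ha := ppSmoothScale_pos hlo e
  have hs := ppSmoothScale_pos hlo u
  have h1 : 1 - ppSmoothRatio lo e u = ppSmoothScale lo u / (ppSmoothScale lo e + ppSmoothScale lo u) := by
    unfold ppSmoothRatio; field_simp; ring
  rw [h1, le_div_iff₀ (by positivity)] at hr
  linarith

/-! ## §4 Every level: the factors `κ(r)`, `κ(1−r)`, `1 − κ(r) − κ(1−r)` at every order -/

section All

variable {lo : ℝ} (hlo : 0 < lo) {κ : ℝ → ℝ} (hκ : ContDiff ℝ (⊤ : ℕ∞) κ) {t₁ : ℝ} (ht₀ : 0 < t₁) (ht23 : t₁ ≤ 2 / 3)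
  (h1 : ∀ t, t ≤ t₁ / 2 → κ t = 1) (h0 : ∀ t, t₁ ≤ t → κ t = 0)
  {n : ℕ} {Xκ : ℝ} (hX : ∀ i ≤ n, ∀ t : ℝ, |iteratedDeriv i κ t| ≤ Xκ)
include hlo hκ ht₀ ht23 h1 h0 hX

/-- **`κ(r(e,·))` AT EVERY ORDER AND EVERY LEVEL**: `|∂ᵤⁿ κ(r(e,·))(u)| ≤ n!·X_κ·((n!)²·(4/t₁)·(1/(m̃ₑ+m̃ᵤ)))ⁿ` (zero off the transition zone
`t₁/2 ≤ r ≤ t₁`; on it `(1−t₁)(m̃ₑ+m̃ᵤ) ≤ m̃ᵤ` and `2/(1−t₁) ≤ 4/t₁`... no: `2/(1−t₁) ≤ 6 ≤ 4/t₁` for `t₁ ≤ 2/3`). [cite: BenfattoGiulianiMastropietro2006, §2.4 (2.36)] -/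
theorem abs_iteratedDeriv_comp_ppSmoothRatio_le (e u : ℝ) :
    |iteratedDeriv n (fun v : ℝ => κ (ppSmoothRatio lo e v)) u| ≤
      n ! * Xκ * (((n ! : ℝ)) ^ 2 * (4 / t₁) * (1 / (ppSmoothScale lo e + ppSmoothScale lo u))) ^ n := by
  have ha := ppSmoothScale_pos hlo e
  have hs := ppSmoothScale_pos hlo u
  have hX0 : 0 ≤ Xκ := (abs_nonneg _).trans (hX 0 (Nat.zero_le _) 0)
  have hRHS : 0 ≤ n ! * Xκ * (((n ! : ℝ)) ^ 2 * (4 / t₁) * (1 / (ppSmoothScale lo e + ppSmoothScale lo u))) ^ n := by positivity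
  rcases Nat.eq_zero_or_pos n with rfl | hn
  · simp only [iteratedDeriv_zero, Nat.factorial_zero, Nat.cast_one, one_mul, pow_zero, mul_one]
    exact hX 0 le_rfl _
  rcases lt_trichotomy (ppSmoothRatio lo e u) (t₁ / 2) with hlt | hge
  · rw [iteratedDeriv_comp_ppSmoothRatio_eq_zero_of_lt hlo h1 hlt hn, abs_zero]; exact hRHS
  · by_cases hgt : t₁ < ppSmoothRatio lo e u
    · rw [iteratedDeriv_comp_ppSmoothRatio_eq_zero_of_gt hlo h0 hgt n, abs_zero]; exact hRHS
    · -- on the closed zone `t₁/2 ≤ r ≤ t₁`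
      have hrle : ppSmoothRatio lo e u ≤ t₁ := le_of_not_gt hgt
      have hz := zone_of_ppSmoothRatio_le hlo hrle
      have hc : 0 < 1 - t₁ := by linarith
      refine (abs_iteratedDeriv_comp_ppSmoothRatio_le_of_zone hlo hκ hX hc hz).trans ?_
      have hcmp : 2 / (1 - t₁) ≤ 4 / t₁ := by rw [div_le_div_iff₀ hc ht₀]; nlinarith
      gcongr

omit ht23 in
/-- **`κ(1 − r(e,·))` AT EVERY ORDER AND EVERY LEVEL**: the same bound (zone `t₁/2 ≤ 1 − r ≤ t₁`, on which `(t₁/2)(m̃ₑ+m̃ᵤ) ≤ m̃ᵤ`). [cite: BenfattoGiulianiMastropietro2006, §2.4 (2.36)] -/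
theorem abs_iteratedDeriv_comp_one_sub_ppSmoothRatio_le (e u : ℝ) :
    |iteratedDeriv n (fun v : ℝ => κ (1 - ppSmoothRatio lo e v)) u| ≤
      n ! * Xκ * (((n ! : ℝ)) ^ 2 * (4 / t₁) * (1 / (ppSmoothScale lo e + ppSmoothScale lo u))) ^ n := by
  have ha := ppSmoothScale_pos hlo e
  have hs := ppSmoothScale_pos hlo u
  have hX0 : 0 ≤ Xκ := (abs_nonneg _).trans (hX 0 (Nat.zero_le _) 0)
  have hRHS : 0 ≤ n ! * Xκ * (((n ! : ℝ)) ^ 2 * (4 / t₁) * (1 / (ppSmoothScale lo e + ppSmoothScale lo u))) ^ n := by positivity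
  rcases Nat.eq_zero_or_pos n with rfl | hn
  · simp only [iteratedDeriv_zero, Nat.factorial_zero, Nat.cast_one, one_mul, pow_zero, mul_one]
    exact hX 0 le_rfl _
  rcases lt_or_ge (1 - ppSmoothRatio lo e u) (t₁ / 2) with hlt | hge
  · rw [iteratedDeriv_comp_one_sub_ppSmoothRatio_eq_zero_of_lt hlo h1 hlt hn, abs_zero]; exact hRHS
  · by_cases hgt : t₁ < 1 - ppSmoothRatio lo e u
    · rw [iteratedDeriv_comp_one_sub_ppSmoothRatio_eq_zero_of_gt hlo h0 hgt n, abs_zero]; exact hRHS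
    · have hz := zone_of_le_one_sub_ppSmoothRatio hlo hge
      have hc : 0 < t₁ / 2 := by positivity
      refine (abs_iteratedDeriv_comp_one_sub_ppSmoothRatio_le_of_zone hlo hκ hX hc hz).trans ?_
      have hcmp : 2 / (t₁ / 2) ≤ 4 / t₁ := by rw [div_div_eq_mul_div]; exact le_of_eq (by ring)
      gcongr

/-- **THE COMPARABLE-LEVELS FACTOR `m = 1 − κ(r) − κ(1−r)` AT EVERY ORDER**: `|∂ᵤⁿ m(e,·)(u)| ≤ [n = 0] + 2·n!·X_κ·((n!)²·(4/t₁)·(1/(m̃ₑ+m̃ᵤ)))ⁿ`.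
[cite: BenfattoGiulianiMastropietro2006, §2.4 (2.36)] -/
theorem abs_iteratedDeriv_midFactor_le (e u : ℝ) :
    |iteratedDeriv n (fun v : ℝ => 1 - κ (ppSmoothRatio lo e v) - κ (1 - ppSmoothRatio lo e v)) u| ≤
      (if n = 0 then 1 else 0) + 2 * (n ! * Xκ * (((n ! : ℝ)) ^ 2 * (4 / t₁) * (1 / (ppSmoothScale lo e + ppSmoothScale lo u))) ^ n) := by
  have hA := abs_iteratedDeriv_comp_ppSmoothRatio_le hlo hκ ht₀ ht23 h1 h0 hX e u
  have hB := abs_iteratedDeriv_comp_one_sub_ppSmoothRatio_le hlo hκ ht₀ h1 h0 hX e u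
  have hN : ((n : ℕ∞) : WithTop ℕ∞) ≤ ((⊤ : ℕ∞) : WithTop ℕ∞) := by exact_mod_cast le_top
  have hcA : ContDiffAt ℝ n (fun v : ℝ => κ (ppSmoothRatio lo e v)) u :=
    ((hκ.of_le hN).comp (contDiff_ppSmoothRatio hlo e)).contDiffAt
  have hcB : ContDiffAt ℝ n (fun v : ℝ => κ (1 - ppSmoothRatio lo e v)) u :=
    ((hκ.of_le hN).comp (contDiff_const.sub (contDiff_ppSmoothRatio hlo e))).contDiffAt
  have hc1 : ContDiffAt ℝ n (fun _ : ℝ => (1 : ℝ)) u := contDiff_const.contDiffAt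
  have hsplit : iteratedDeriv n (fun v : ℝ => 1 - κ (ppSmoothRatio lo e v) - κ (1 - ppSmoothRatio lo e v)) u =
      iteratedDeriv n (fun _ : ℝ => (1 : ℝ)) u - iteratedDeriv n (fun v : ℝ => κ (ppSmoothRatio lo e v)) u -
        iteratedDeriv n (fun v : ℝ => κ (1 - ppSmoothRatio lo e v)) u := by
    have hf1 : (fun v : ℝ => 1 - κ (ppSmoothRatio lo e v) - κ (1 - ppSmoothRatio lo e v)) =
        (fun v : ℝ => 1 - κ (ppSmoothRatio lo e v)) - fun v : ℝ => κ (1 - ppSmoothRatio lo e v) := rfl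
    have hf2 : (fun v : ℝ => 1 - κ (ppSmoothRatio lo e v)) = (fun _ : ℝ => (1 : ℝ)) - fun v : ℝ => κ (ppSmoothRatio lo e v) := rfl
    rw [hf1, iteratedDeriv_sub (hc1.sub hcA) hcB, hf2, iteratedDeriv_sub hc1 hcA]
  rw [hsplit, iteratedDeriv_const]
  have h1abs : |(if n = 0 then (1 : ℝ) else 0)| = if n = 0 then 1 else 0 := by split_ifs <;> simp
  calc |(if n = 0 then (1 : ℝ) else 0) - iteratedDeriv n (fun v : ℝ => κ (ppSmoothRatio lo e v)) u -
        iteratedDeriv n (fun v : ℝ => κ (1 - ppSmoothRatio lo e v)) u|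
      ≤ |(if n = 0 then (1 : ℝ) else 0) - iteratedDeriv n (fun v : ℝ => κ (ppSmoothRatio lo e v)) u| +
          |iteratedDeriv n (fun v : ℝ => κ (1 - ppSmoothRatio lo e v)) u| := abs_sub _ _
    _ ≤ (|(if n = 0 then (1 : ℝ) else 0)| + |iteratedDeriv n (fun v : ℝ => κ (ppSmoothRatio lo e v)) u|) +
          |iteratedDeriv n (fun v : ℝ => κ (1 - ppSmoothRatio lo e v)) u| := by gcongr; exact abs_sub _ _
    _ ≤ _ := by rw [h1abs]; linarith

end All

/-! ## §5 The concrete profile `ppSplitProfile t₁ = smoothTransition(2 − 2t/t₁)` -/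

/-- **The jets of the concrete profile**: `∂ⁿ(ppSplitProfile t₁)(t) = (2/t₁)ⁿ·(−1)ⁿ·smoothTransition⁽ⁿ⁾(2 − (2/t₁)t)`. [folklore] -/
theorem iteratedDeriv_ppSplitProfile (t₁ : ℝ) (n : ℕ) (t : ℝ) :
    iteratedDeriv n (ppSplitProfile t₁) t = (2 / t₁) ^ n * ((-1 : ℝ) ^ n * iteratedDeriv n Real.smoothTransition (2 - 2 / t₁ * t)) := by
  have hfun : ppSplitProfile t₁ = fun s : ℝ => (fun z : ℝ => Real.smoothTransition (2 - z)) (2 / t₁ * s) := by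
    funext s; rfl
  have hg : ContDiff ℝ n (fun z : ℝ => Real.smoothTransition (2 - z)) := Real.smoothTransition.contDiff.comp (contDiff_const.sub contDiff_id)
  rw [hfun, iteratedDeriv_comp_const_mul hg (2 / t₁)]
  dsimp only
  rw [iteratedDeriv_comp_const_sub n Real.smoothTransition 2]
  simp [smul_eq_mul]

/-- **Gevrey-2 numerals for the concrete profile**: `|∂ⁿ(ppSplitProfile t₁)(t)| ≤ 8·(n!)²·(512/t₁)ⁿ` (`0 < t₁`). [cite: DisertoriRivasseau2000, §II.2 (II.14) footnote] -/
theorem abs_iteratedDeriv_ppSplitProfile_le {t₁ : ℝ} (ht₀ : 0 < t₁) (n : ℕ) (t : ℝ) :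
    |iteratedDeriv n (ppSplitProfile t₁) t| ≤ 8 * ((n ! : ℝ)) ^ 2 * (512 / t₁) ^ n := by
  rw [iteratedDeriv_ppSplitProfile, abs_mul, abs_mul, abs_pow, abs_pow, abs_neg, abs_one, one_pow, one_mul, abs_of_pos (by positivity : (0 : ℝ) < 2 / t₁)]
  calc (2 / t₁) ^ n * |iteratedDeriv n Real.smoothTransition (2 - 2 / t₁ * t)| ≤ (2 / t₁) ^ n * (8 * ((n ! : ℝ)) ^ 2 * 256 ^ n) :=
        mul_le_mul_of_nonneg_left (abs_iteratedDeriv_smoothTransition_le_numeral n _) (by positivity)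
    _ = 8 * ((n ! : ℝ)) ^ 2 * ((2 / t₁) ^ n * 256 ^ n) := by ring
    _ = 8 * ((n ! : ℝ)) ^ 2 * (512 / t₁) ^ n := by rw [← mul_pow]; congr 1; ring

/-- **The flat jet table of the concrete profile to order `n`**: `∀ i ≤ n, ∀ t, |∂ⁱ(ppSplitProfile t₁)(t)| ≤ 8·(n!)²·(512/t₁)ⁿ` (`0 < t₁ ≤ 512`).
[cite: DisertoriRivasseau2000, §II.2 (II.14) footnote] -/
theorem ppSplitProfile_jetTable {t₁ : ℝ} (ht₀ : 0 < t₁) (ht : t₁ ≤ 512) (n : ℕ) :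
    ∀ i ≤ n, ∀ t : ℝ, |iteratedDeriv i (ppSplitProfile t₁) t| ≤ 8 * ((n ! : ℝ)) ^ 2 * (512 / t₁) ^ n := by
  intro i hi t
  refine (abs_iteratedDeriv_ppSplitProfile_le ht₀ i t).trans ?_
  have hfac : ((i ! : ℝ)) ≤ n ! := by exact_mod_cast Nat.factorial_le hi
  have hq : (1 : ℝ) ≤ 512 / t₁ := by rw [le_div_iff₀ ht₀]; linarith
  have hpow : (512 / t₁) ^ i ≤ (512 / t₁) ^ n := pow_le_pow_right₀ hq hi
  gcongr

/-- The concrete profile meets the abstract hypotheses: smooth, `= 1` below `t₁/2`, `= 0` above `t₁`. [folklore] -/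
theorem ppSplitProfile_hyps {t₁ : ℝ} (ht₀ : 0 < t₁) :
    ContDiff ℝ (⊤ : ℕ∞) (ppSplitProfile t₁) ∧ (∀ t, t ≤ t₁ / 2 → ppSplitProfile t₁ t = 1) ∧ (∀ t, t₁ ≤ t → ppSplitProfile t₁ t = 0) :=
  ⟨contDiff_ppSplitProfile t₁, fun _ ht => ppSplitProfile_eq_one_of_le ht₀ ht, fun _ ht => ppSplitProfile_eq_zero_of_le ht₀ ht⟩

end Summit.HubbardSuperconductivity.HubbardSuperconductivity.Theorems.C4a

end
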